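import Mathlib.LinearAlgebra.Matrix.Transvection
import Mathlib.LinearAlgebra.Matrix.Permutation
import Mathlib.Algebra.MvPolynomial.Funext
import Mathlib.FieldTheory.IsAlgClosed.Basic
import Literature.Computability.AlgebraicComplexity.BILPS19MinrankVarieties
import Literature.Computability.AlgebraicComplexity.QuantumFunctionalsFree
import HarnessLib

/-!
# BILPS Thm 22 discharged: `T_{k,n,r}` is characterised by its stabilizer

Source: M. Bläser, C. Ikenmeyer, V. Lysikov, A. Pandey, F.-O. Schreyer, *Variety membership testing,
algebraic natural proofs, and geometric complexity theory*, arXiv:1911.02534 (bib key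
`BlaserIkenmeyerLysikovPandeySchreyer2019`; SODA 2021), Thm 22, p0024:L47–62 of the held text
(`lit read paper:arxiv-1911.02534`). This file proves the named fact
`BILPS2019_thm22` of `BILPS19MinrankVarieties.lean` (val-lit row X5-BILPS19) AS TYPED:

* if `Stab T = Stab T_{k,n,r}` then `T ∈ (GL_k × GL_s × GL_s)·T_{k,n,r}`;
* if `Stab T ⊇ Stab T_{k,n,r}` then `T` lies in the (Zariski) orbit closure of `T_{k,n,r}`;

for `1 ≤ r < n` over an algebraically closed field (only "infinite field" is used).

We FOLLOW THE PRINTED PROOF (p0024:L47–62), which never uses the full stabilizer computation of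
Thm 21 but only that three explicit families of elements stabilise `T_{k,n,r}`:
1. the tori `(A_i(λ⁻²), B_i(λ), B_i(λ))` (`A_i` scales the `i`-th coordinate of `F^k`, `B_i` scales
   the summand `L_i`): invariance of `T` forces every slice `T_i` to be supported in its diagonal
   block `L_i ⊗ L_i` (`support_of_stab`);
2. the block conjugations `(1, diag(Z_1,…,Z_k), diag(Z_1,…,Z_k)^{-T})` — it suffices to take
   transvections `Z = 1 + E_{b₁b₂}` inside one block: invariance forces each diagonal block to be a
   scalar matrix `a_i·1` (`offdiag_of_stab`, `shape_of_stab`);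
3. the simultaneous block permutations: invariance forces `a_2 = ⋯ = a_k`
   (`perm_invariance_of_stab`).
Hence `T = (diag(a_1, a_2, …, a_2) ⊗ 1 ⊗ 1)·T_{k,n,r}` (`exists_eq_actTensor_diagonal`). If
`a_1 a_2 ≠ 0` this is a point of the orbit; in general it is a point of the orbit closure — the
printed "the closure of the set of tensors of this form with `a_1 ≠ 0` and `a_2 ≠ 0` includes the
cases when `a_1` or `a_2` are zero" is made explicit as: a polynomial vanishing on the orbit vanishes
on the two-parameter linear family `{(diag(x,y,…,y) ⊗ 1 ⊗ 1)·T_{k,n,r}}` for `xy ≠ 0`, hence (infinite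
field, `MvPolynomial.funext_set`) on the whole family (`smul_add_smul_mem_zariskiClosure`). In the
border cases `a_1 = 0` (resp. `a_2 = 0`) the printed "`T` has more symmetries than `T_{k,n,r}`" is the
explicit element `(1, B_1(λ), 1)` (resp. `(1, B_2(λ), 1)`), which stabilises `T` but not `T_{k,n,r}`
(`stab3_ne_of_coeff_eq_zero`; this is where the typed hypothesis `1 ≤ r` enters). No step deviates
from the print; the generic core is stated for an arbitrary block labelling `β : κ → ι` and the
"block identity tensor" `t₀ a b c = [b = c ∧ β b = a]`, of which `bilpsTensor` is the instance
`β = Sum.elim (fun _ ↦ none) (fun p ↦ some p.2)` (`bilpsTensor_apply`).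

Theorem-only file: no new definitions, no new named facts (D-0026). Honest framing (val-lit): a
published theorem about the tensors `T_{k,n,r}`; nothing here bears on `VP ≠ VNP`.
-/

noncomputable section

open Matrix MvPolynomial

namespace Literature.Computability.AlgebraicComplexity

namespace BILPS2019

variable {F : Type*} [Field F]

/-! ### Generic tools: slices of `(1 ⊗ B ⊗ C)·t`, permutation triples, explicit `GL` elements -/

section Generic

variable {ι κ μ : Type*} [Fintype ι] [Fintype κ] [Fintype μ]
  [DecidableEq ι] [DecidableEq κ] [DecidableEq μ]

omit [DecidableEq κ] [DecidableEq μ] in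
/-- The `a`-th slice of `(1 ⊗ B ⊗ C)·t` is `B · t_a · Cᵀ` (proof of Thm 21/22: "it preserves
`T_{k,n,r}` if and only if `B̂ ⊗ Ĉ` preserves each slice", p0024:L28).
[cite: BlaserIkenmeyerLysikovPandeySchreyer2019, Thm. 21 (proof)] -/
theorem of_actTensor_one (B : Matrix κ κ F) (C : Matrix μ μ F) (t : ι → κ → μ → F) (a : ι) :
    Matrix.of (actTensor (1 : Matrix ι ι F) B C t a) = B * Matrix.of (t a) * Cᵀ := by
  ext b c
  rw [Matrix.of_apply, actTensor_apply, Finset.sum_eq_single_of_mem a (Finset.mem_univ a)]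
  · simp only [Matrix.one_apply_eq, one_mul, Matrix.mul_apply, Matrix.transpose_apply,
      Matrix.of_apply]
    rw [Finset.sum_comm]
    refine Finset.sum_congr rfl fun c' _ => ?_
    rw [Finset.sum_mul]
    exact Finset.sum_congr rfl fun b' _ => by ring
  · intro a' _ ha'
    simp [Matrix.one_apply_ne' ha']

omit [DecidableEq κ] [DecidableEq μ] in
/-- `(1 ⊗ B ⊗ C)·t = t` iff `B · t_a · Cᵀ = t_a` for every slice `a` (p0024:L28).
[cite: BlaserIkenmeyerLysikovPandeySchreyer2019, Thm. 21 (proof)] -/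
theorem actTensor_one_eq_self_iff (B : Matrix κ κ F) (C : Matrix μ μ F) (t : ι → κ → μ → F) :
    actTensor (1 : Matrix ι ι F) B C t = t ↔ ∀ a, B * Matrix.of (t a) * Cᵀ = Matrix.of (t a) := by
  constructor
  · intro h a
    rw [← of_actTensor_one, h]
  · intro h
    funext a
    have ha := h a
    rw [← of_actTensor_one] at ha
    exact Matrix.of.injective ha

/-- Entries of a permutation matrix: `(P_σ)_{xy} = [y = σ x]` (private helper). [folklore] -/
private theorem permMatrix_apply_eq_ite {ν : Type*} [DecidableEq ν] (σ : Equiv.Perm ν) (x y : ν) :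
    (σ.permMatrix F) x y = if y = σ x then 1 else 0 := by
  simp [Equiv.Perm.permMatrix, PEquiv.toMatrix_apply, Equiv.toPEquiv_apply, eq_comm]

/-- Entries of `(P_π ⊗ P_ρ ⊗ P_θ)·t` for permutation matrices (three index types).
[cite: BlaserIkenmeyerLysikovPandeySchreyer2019, Thm. 21 (proof, the elements P_σ)] -/
theorem actTensor_permMatrix_apply₃ (π : Equiv.Perm ι) (ρ : Equiv.Perm κ) (θ : Equiv.Perm μ)
    (t : ι → κ → μ → F) (a : ι) (b : κ) (c : μ) :
    actTensor (π.permMatrix F) (ρ.permMatrix F) (θ.permMatrix F) t a b c = t (π a) (ρ b) (θ c) := by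
  simp only [actTensor_apply]
  rw [Finset.sum_eq_single (π a)]
  · rw [Finset.sum_eq_single (ρ b)]
    · rw [Finset.sum_eq_single (θ c)]
      · rw [permMatrix_apply_eq_ite, permMatrix_apply_eq_ite, permMatrix_apply_eq_ite, if_pos rfl,
          if_pos rfl, if_pos rfl, one_mul, one_mul, one_mul]
      · intro c' _ hc'
        rw [permMatrix_apply_eq_ite θ c c', if_neg hc', mul_zero, zero_mul]
      · intro h; exact absurd (Finset.mem_univ _) h
    · intro b' _ hb'
      exact Finset.sum_eq_zero fun c' _ => by
        rw [permMatrix_apply_eq_ite ρ b b', if_neg hb', mul_zero, zero_mul, zero_mul]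
    · intro h; exact absurd (Finset.mem_univ _) h
  · intro a' _ ha'
    exact Finset.sum_eq_zero fun b' _ => Finset.sum_eq_zero fun c' _ => by
      rw [permMatrix_apply_eq_ite π a a', if_neg ha', zero_mul, zero_mul, zero_mul]
  · intro h; exact absurd (Finset.mem_univ _) h

/-- An invertible diagonal matrix as an element of `GL` (private helper). [folklore] -/
private theorem exists_gl_diagonal (d : ι → F) (hd : ∀ i, d i ≠ 0) :
    ∃ A : GL ι F, (A : Matrix ι ι F) = diagonal d :=
  ⟨⟨diagonal d, diagonal fun i => (d i)⁻¹, by simp [mul_inv_cancel₀, hd],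
    by simp [inv_mul_cancel₀, hd]⟩, rfl⟩

/-- A permutation matrix as an element of `GL` (private helper). [folklore] -/
private theorem exists_gl_permMatrix (σ : Equiv.Perm ι) :
    ∃ A : GL ι F, (A : Matrix ι ι F) = σ.permMatrix F :=
  ⟨⟨σ.permMatrix F, σ⁻¹.permMatrix F,
    by rw [← Matrix.permMatrix_mul, inv_mul_cancel, Matrix.permMatrix_one],
    by rw [← Matrix.permMatrix_mul, mul_inv_cancel, Matrix.permMatrix_one]⟩, rfl⟩

/-- A transvection `1 + E_{ij}` (`i ≠ j`) as an element of `GL` (private helper). [folklore] -/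
private theorem exists_gl_transvection {i j : κ} (hij : i ≠ j) (c : F) :
    ∃ B : GL κ F, (B : Matrix κ κ F) = transvection i j c :=
  ⟨⟨transvection i j c, transvection i j (-c),
    by rw [transvection_mul_transvection_same _ _ hij, add_neg_cancel, transvection_zero],
    by rw [transvection_mul_transvection_same _ _ hij, neg_add_cancel, transvection_zero]⟩, rfl⟩

/-- The transpose-inverse `(1 + E_{ij})^{-T}` as an element of `GL` (private helper). [folklore] -/
private theorem exists_gl_transvection_transpose {i j : κ} (hij : i ≠ j) (c : F) :
    ∃ C : GL κ F, (C : Matrix κ κ F) = (transvection i j (-c))ᵀ :=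
  ⟨⟨(transvection i j (-c))ᵀ, (transvection i j c)ᵀ,
    by rw [← transpose_mul, transvection_mul_transvection_same _ _ hij, add_neg_cancel,
      transvection_zero, transpose_one],
    by rw [← transpose_mul, transvection_mul_transvection_same _ _ hij, neg_add_cancel,
      transvection_zero, transpose_one]⟩, rfl⟩

end Generic

/-! ### A polynomial vanishing on a two-parameter linear family off the axes vanishes on it -/

section Zariski

/-- If `x•v₀ + y•v₁ ∈ S` whenever `x ≠ 0 ≠ y`, then every `x•v₀ + y•v₁` lies in the Zariski closure
of `S` (infinite field): the printed "the closure of the set of tensors of this form with `a_1 ≠ 0`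
and `a_2 ≠ 0` includes the cases when `a_1` or `a_2` are zero" (p0024:L60).
[cite: BlaserIkenmeyerLysikovPandeySchreyer2019, Thm. 22 (proof)] -/
theorem smul_add_smul_mem_zariskiClosure {P : Type*} [Infinite F]
    (S : Set (P → F)) (v₀ v₁ : P → F)
    (h : ∀ x y : F, x ≠ 0 → y ≠ 0 → x • v₀ + y • v₁ ∈ S) (x y : F) :
    x • v₀ + y • v₁ ∈ zariskiClosure S := by
  rw [mem_zariskiClosure_iff]
  intro p hp
  let g : P → MvPolynomial (Fin 2) F := fun pt => C (v₀ pt) * X 0 + C (v₁ pt) * X 1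
  have hev : ∀ v : Fin 2 → F, aeval v (aeval g p) = aeval (v 0 • v₀ + v 1 • v₁) p := by
    intro v
    have hg : (fun pt => aeval v (g pt)) = v 0 • v₀ + v 1 • v₁ := by
      funext pt
      simp only [g, map_add, map_mul, aeval_C, aeval_X, Algebra.algebraMap_self_apply,
        Pi.add_apply, Pi.smul_apply, smul_eq_mul]
      ring
    rw [comp_aeval_apply, hg]
  have hzero : aeval g p = 0 := by
    refine MvPolynomial.funext_set (fun _ : Fin 2 => ({0} : Set F)ᶜ)
      (fun _ => (Set.finite_singleton (0 : F)).infinite_compl) fun v hv => ?_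
    rw [Set.mem_univ_pi] at hv
    have h0 : v 0 ≠ 0 := Set.mem_compl_singleton_iff.1 (hv 0)
    have h1 : v 1 ≠ 0 := Set.mem_compl_singleton_iff.1 (hv 1)
    change aeval v (aeval g p) = aeval v (0 : MvPolynomial (Fin 2) F)
    rw [map_zero, hev]
    exact hp _ (h _ _ h0 h1)
  have hxy := hev ![x, y]
  rw [hzero, map_zero] at hxy
  simpa using hxy.symm

end Zariski

/-! ### Generic core: tensors stabilised by the explicit stabilizer elements of a block identity
tensor `t₀ a b c = [b = c ∧ β b = a]` -/

section Core

variable {ι κ : Type*} [Fintype ι] [Fintype κ] [DecidableEq ι] [DecidableEq κ]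
  (β : κ → ι) {t₀ : ι → κ → κ → F}
  (ht₀ : ∀ a b c, t₀ a b c = if b = c ∧ β b = a then 1 else 0)
include ht₀

omit [Fintype ι] [Fintype κ] in
/-- The slices of the block identity tensor are the diagonal block indicators.
[cite: BlaserIkenmeyerLysikovPandeySchreyer2019, §6.1 (definition of T_{k,n,r})] -/
theorem of_slice_eq_diagonal (a : ι) :
    Matrix.of (t₀ a) = diagonal fun b => if β b = a then (1 : F) else 0 := by
  ext b c
  rw [Matrix.of_apply, ht₀, diagonal_apply]
  by_cases hbc : b = c
  · subst hbc; simp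
  · simp [hbc]

/-- Family 1 of the printed proof: the torus element `(A_i(λ⁻²), B_i(λ), B_i(λ))` stabilises the
block identity tensor (p0024:L51–53). [cite: BlaserIkenmeyerLysikovPandeySchreyer2019, Thm. 22 (proof)] -/
theorem torus_mem_stab3 (i : ι) {c : F} (hc : c ≠ 0) (A : GL ι F) (B : GL κ F)
    (hA : (A : Matrix ι ι F) = diagonal fun a => if a = i then (c * c)⁻¹ else 1)
    (hB : (B : Matrix κ κ F) = diagonal fun b => if β b = i then c else 1) :
    (A, B, B) ∈ stab3 t₀ := by
  show actTensor (A : Matrix ι ι F) (B : Matrix κ κ F) (B : Matrix κ κ F) t₀ = t₀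
  rw [hA, hB]
  funext a b b'
  simp only [actTensor_diagonal_apply, ht₀]
  by_cases h : b = b' ∧ β b = a
  · obtain ⟨rfl, rfl⟩ := h
    rw [if_pos (And.intro rfl rfl), mul_one]
    by_cases hi : β b = i
    · simp only [hi, if_true]
      rw [mul_assoc, inv_mul_cancel₀ (mul_ne_zero hc hc)]
    · simp [hi]
  · rw [if_neg h, mul_zero]

/-- Consequence of family 1: a tensor stabilised by `Stab t₀` has each slice `T_a` supported in the
diagonal block `L_a ⊗ L_a` ("all blocks of `T_i` except `T_{iii}` are zero", p0024:L53). Needs a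
scalar `c` with `c ≠ 0`, `c ≠ 1`, `c² ≠ 1`. [cite: BlaserIkenmeyerLysikovPandeySchreyer2019, Thm. 22 (proof)] -/
theorem support_of_stab (T : ι → κ → κ → F) (hst : stab3 t₀ ⊆ stab3 T)
    {c : F} (hc0 : c ≠ 0) (hc1 : c ≠ 1) (hc2 : c * c ≠ 1) (a : ι) (b b' : κ)
    (hT : T a b b' ≠ 0) : β b = a ∧ β b' = a := by
  have key : ∀ i : ι, (if a = i then (c * c)⁻¹ else 1) * (if β b = i then c else 1) *
      (if β b' = i then c else 1) * T a b b' = T a b b' := by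
    intro i
    obtain ⟨A, hA⟩ := exists_gl_diagonal (fun a => if a = i then (c * c)⁻¹ else (1 : F))
      (fun x => by split_ifs <;> simp [hc0])
    obtain ⟨B, hB⟩ := exists_gl_diagonal (fun b => if β b = i then c else (1 : F))
      (fun x => by split_ifs <;> simp [hc0])
    have hmem0 := hst (torus_mem_stab3 β ht₀ i hc0 A B hA hB)
    have hmem : actTensor (A : Matrix ι ι F) (B : Matrix κ κ F) (B : Matrix κ κ F) T = T := hmem0
    have h := congrFun (congrFun (congrFun hmem a) b) b'
    rw [hA, hB] at h
    simpa only [actTensor_diagonal_apply] using h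
  have kill : ∀ {x : F}, x ≠ 1 → x * T a b b' = T a b b' → False := by
    intro x hx h
    have h' : (x - 1) * T a b b' = 0 := by rw [sub_mul, one_mul, h, sub_self]
    exact hT ((mul_eq_zero.1 h').resolve_left (sub_ne_zero.2 hx))
  constructor
  · by_contra hb
    have h := key (β b)
    rw [if_neg (Ne.symm hb), if_pos rfl, one_mul] at h
    by_cases hb' : β b' = β b
    · rw [if_pos hb'] at h
      exact kill hc2 h
    · rw [if_neg hb', mul_one] at h
      exact kill hc1 h
  · by_contra hb'
    have h := key (β b')
    rw [if_neg (Ne.symm hb'), if_pos rfl, one_mul] at h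
    by_cases hb : β b = β b'
    · rw [if_pos hb] at h
      exact kill hc2 h
    · rw [if_neg hb, one_mul] at h
      exact kill hc1 h

/-- Family 2 of the printed proof, transvection case: for `b₁ ≠ b₂` in the same block,
`(1, 1 + E_{b₁b₂}, (1 + E_{b₁b₂})^{-T})` stabilises the block identity tensor ("any such `B̂` gives
rise to `(1, B̂, B̂^{-T}) ∈ Stab T_{k,n,r}`", p0024:L33; p0024:L54).
[cite: BlaserIkenmeyerLysikovPandeySchreyer2019, Thm. 22 (proof)] -/
theorem transvection_mem_stab3 {b₁ b₂ : κ} (hne : b₁ ≠ b₂) (hblk : β b₁ = β b₂)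
    (B C : GL κ F) (hB : (B : Matrix κ κ F) = transvection b₁ b₂ 1)
    (hC : (C : Matrix κ κ F) = (transvection b₁ b₂ (-1))ᵀ) :
    ((1 : GL ι F), B, C) ∈ stab3 t₀ := by
  show actTensor ((1 : GL ι F) : Matrix ι ι F) (B : Matrix κ κ F) (C : Matrix κ κ F) t₀ = t₀
  rw [Units.val_one, hB, hC, actTensor_one_eq_self_iff]
  intro a
  rw [transpose_transpose, of_slice_eq_diagonal β ht₀ a]
  have hcomm : transvection b₁ b₂ (1 : F) * diagonal (fun b => if β b = a then (1 : F) else 0) =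
      diagonal (fun b => if β b = a then (1 : F) else 0) * transvection b₁ b₂ 1 := by
    ext x y
    simp only [mul_diagonal, diagonal_mul]
    by_cases hxy : x = y
    · subst hxy; ring
    · rw [transvection, Matrix.add_apply, one_apply_ne hxy, zero_add, Matrix.single_apply]
      by_cases h : b₁ = x ∧ b₂ = y
      · obtain ⟨rfl, rfl⟩ := h
        rw [if_pos (And.intro rfl rfl), hblk, one_mul, mul_one]
      · rw [if_neg h, mul_zero, zero_mul]
  rw [hcomm, Matrix.mul_assoc, transvection_mul_transvection_same _ _ hne, add_neg_cancel,
    transvection_zero, Matrix.mul_one]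

/-- Consequence of family 2: for `b₁ ≠ b₂` in one block, the row `b₂` of each slice of a tensor
stabilised by `Stab t₀` vanishes off the diagonal and its diagonal entry equals the one at `b₁`
("each `T_{iii}` has the form `a_i ∑_j e_{ij} ⊗ e_{ij}`", p0024:L54).
[cite: BlaserIkenmeyerLysikovPandeySchreyer2019, Thm. 22 (proof)] -/
theorem offdiag_of_stab (T : ι → κ → κ → F) (hst : stab3 t₀ ⊆ stab3 T) {b₁ b₂ : κ}
    (hne : b₁ ≠ b₂) (hblk : β b₁ = β b₂) (a : ι) :
    (∀ y, y ≠ b₂ → T a b₂ y = 0) ∧ T a b₂ b₂ = T a b₁ b₁ := by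
  obtain ⟨B, hB⟩ := exists_gl_transvection hne (1 : F)
  obtain ⟨C, hC⟩ := exists_gl_transvection_transpose hne (1 : F)
  have hmem0 := hst (transvection_mem_stab3 β ht₀ hne hblk B C hB hC)
  have hmem : actTensor ((1 : GL ι F) : Matrix ι ι F) (B : Matrix κ κ F) (C : Matrix κ κ F) T = T :=
    hmem0
  rw [Units.val_one, hB, hC, actTensor_one_eq_self_iff] at hmem
  have h := hmem a
  rw [transpose_transpose] at h
  have h2 : transvection b₁ b₂ (1 : F) * Matrix.of (T a) = Matrix.of (T a) * transvection b₁ b₂ 1 := by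
    have h' := congrArg (· * transvection b₁ b₂ (1 : F)) h
    simpa only [Matrix.mul_assoc, transvection_mul_transvection_same _ _ hne, neg_add_cancel,
      transvection_zero, Matrix.mul_one] using h'
  constructor
  · intro y hy
    have h3 := congrFun (congrFun h2 b₁) y
    rw [transvection_mul_apply_same, mul_transvection_apply_of_ne _ _ _ _ hy] at h3
    simpa using h3
  · have h3 := congrFun (congrFun h2 b₁) b₂
    rw [transvection_mul_apply_same, mul_transvection_apply_same] at h3
    simpa using h3

/-- Family 3 of the printed proof: a simultaneous permutation of slices and blocks compatible with
the labelling (`β ∘ ρ = π ∘ β`) stabilises the block identity tensor ("It is easy to see that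
`P_σ ∈ Stab T_{k,n,r}`", p0024:L22; p0024:L55).
[cite: BlaserIkenmeyerLysikovPandeySchreyer2019, Thm. 22 (proof)] -/
theorem perm_mem_stab3 (π : Equiv.Perm ι) (ρ : Equiv.Perm κ) (hcomp : ∀ b, β (ρ b) = π (β b))
    (A : GL ι F) (B : GL κ F) (hA : (A : Matrix ι ι F) = π.permMatrix F)
    (hB : (B : Matrix κ κ F) = ρ.permMatrix F) :
    (A, B, B) ∈ stab3 t₀ := by
  show actTensor (A : Matrix ι ι F) (B : Matrix κ κ F) (B : Matrix κ κ F) t₀ = t₀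
  rw [hA, hB]
  funext a b c
  rw [actTensor_permMatrix_apply₃, ht₀, ht₀, hcomp]
  simp only [EmbeddingLike.apply_eq_iff_eq]

/-- Consequence of family 3: a tensor stabilised by `Stab t₀` is invariant under every compatible
simultaneous permutation (p0024:L55). [cite: BlaserIkenmeyerLysikovPandeySchreyer2019, Thm. 22 (proof)] -/
theorem perm_invariance_of_stab (T : ι → κ → κ → F) (hst : stab3 t₀ ⊆ stab3 T)
    (π : Equiv.Perm ι) (ρ : Equiv.Perm κ) (hcomp : ∀ b, β (ρ b) = π (β b)) (a : ι) (b c : κ) :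
    T (π a) (ρ b) (ρ c) = T a b c := by
  obtain ⟨A, hA⟩ := exists_gl_permMatrix (F := F) π
  obtain ⟨B, hB⟩ := exists_gl_permMatrix (F := F) ρ
  have hmem0 := hst (perm_mem_stab3 β ht₀ π ρ hcomp A B hA hB)
  have hmem : actTensor (A : Matrix ι ι F) (B : Matrix κ κ F) (B : Matrix κ κ F) T = T := hmem0
  have h := congrFun (congrFun (congrFun hmem a) b) c
  rwa [hA, hB, actTensor_permMatrix_apply₃] at h

/-- Families 1 + 2 combined: a tensor stabilised by `Stab t₀` is block-scalar,
`T_a = τ(a) · 1_{L_a}` with `τ(a) = T_a(e_a, e_a)` for any chosen representative `e_a` of block `a`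
(p0024:L53–54). [cite: BlaserIkenmeyerLysikovPandeySchreyer2019, Thm. 22 (proof)] -/
theorem shape_of_stab (T : ι → κ → κ → F) (hst : stab3 t₀ ⊆ stab3 T)
    {c : F} (hc0 : c ≠ 0) (hc1 : c ≠ 1) (hc2 : c * c ≠ 1) (e : ι → κ) (he : ∀ a, β (e a) = a)
    (a : ι) (b b' : κ) :
    T a b b' = if b = b' ∧ β b = a then T a (e a) (e a) else 0 := by
  by_cases h : b = b' ∧ β b = a
  · obtain ⟨rfl, hb⟩ := h
    rw [if_pos (And.intro rfl hb)]
    by_cases hbe : b = e a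
    · rw [hbe]
    · exact (offdiag_of_stab β ht₀ T hst (Ne.symm hbe) ((he a).trans hb.symm) a).2
  · rw [if_neg h]
    by_contra hT
    obtain ⟨hb, hb'⟩ := support_of_stab β ht₀ T hst hc0 hc1 hc2 a b b' hT
    have hne : b ≠ b' := fun hbb => h ⟨hbb, hb⟩
    exact hT ((offdiag_of_stab β ht₀ T hst (Ne.symm hne) (hb'.trans hb.symm) a).1 b' (Ne.symm hne))

/-- Families 1 + 2: `T = (diag(τ) ⊗ 1 ⊗ 1)·t₀` with `τ(a) = T_a(e_a, e_a)` (p0024:L56, before the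
permutation step). [cite: BlaserIkenmeyerLysikovPandeySchreyer2019, Thm. 22 (proof)] -/
theorem eq_actTensor_diagonal_of_stab (T : ι → κ → κ → F) (hst : stab3 t₀ ⊆ stab3 T)
    {c : F} (hc0 : c ≠ 0) (hc1 : c ≠ 1) (hc2 : c * c ≠ 1) (e : ι → κ) (he : ∀ a, β (e a) = a) :
    T = actTensor (diagonal fun a => T a (e a) (e a)) (1 : Matrix κ κ F) (1 : Matrix κ κ F) t₀ := by
  funext a b b'
  rw [← diagonal_one, shape_of_stab β ht₀ T hst hc0 hc1 hc2 e he]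
  simp only [actTensor_diagonal_apply, ht₀]
  split_ifs <;> simp

/-- Border cases of the printed proof: if the coefficient of block `a₀` vanishes, the tensor
`(diag(d) ⊗ 1 ⊗ 1)·t₀` has a symmetry `(1, B_{a₀}(λ), 1)` that `t₀` lacks ("In these border cases,
`T` has more symmetries than `T_{k,n,r}`, for example, multiplication of the zero blocks by an
arbitrary matrix", p0024:L61), so the stabilizers differ. Needs a representative `e a₀` of the block
and a scalar `l ∉ {0, 1}`. [cite: BlaserIkenmeyerLysikovPandeySchreyer2019, Thm. 22 (proof)] -/
theorem stab3_ne_of_coeff_eq_zero (d : ι → F) (a₀ : ι) (hd : d a₀ = 0) (e₀ : κ) (he : β e₀ = a₀)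
    {l : F} (hl0 : l ≠ 0) (hl1 : l ≠ 1) :
    stab3 (actTensor (diagonal d) (1 : Matrix κ κ F) (1 : Matrix κ κ F) t₀) ≠ stab3 t₀ := by
  intro heq
  obtain ⟨B, hB⟩ := exists_gl_diagonal (fun b => if β b = a₀ then l else (1 : F))
    (fun x => by split_ifs <;> simp [hl0])
  have hmem : ((1 : GL ι F), B, (1 : GL κ F)) ∈
      stab3 (actTensor (diagonal d) (1 : Matrix κ κ F) (1 : Matrix κ κ F) t₀) := by
    show actTensor ((1 : GL ι F) : Matrix ι ι F) (B : Matrix κ κ F) ((1 : GL κ F) : Matrix κ κ F)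
      (actTensor (diagonal d) (1 : Matrix κ κ F) (1 : Matrix κ κ F) t₀) =
      actTensor (diagonal d) (1 : Matrix κ κ F) (1 : Matrix κ κ F) t₀
    rw [Units.val_one, Units.val_one, hB]
    funext a b b'
    rw [← diagonal_one, ← diagonal_one]
    simp only [actTensor_diagonal_apply, ht₀]
    by_cases h : b = b' ∧ β b = a
    · obtain ⟨rfl, rfl⟩ := h
      by_cases hb : β b = a₀
      · rw [hb, hd]; simp
      · rw [if_neg hb]; simp
    · rw [if_neg h]; simp
  rw [heq] at hmem
  have h := congrFun (congrFun (congrFun hmem a₀) e₀) e₀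
  rw [Units.val_one, Units.val_one, hB, ← diagonal_one, ← diagonal_one] at h
  simp only [actTensor_diagonal_apply] at h
  rw [ht₀, if_pos (And.intro rfl he), if_pos he] at h
  simp only [mul_one, one_mul] at h
  exact hl1 h

end Core

/-! ### The instance `T_{k,n,r}`: block labelling of `L = F^r ⊕ (F^n)^{k-1}` and assembly -/

section Specific

variable (F)

/-- `T_{k,n,r}` is the block identity tensor for the labelling `inl _ ↦ none` (block `L_1 = F^r`),
`inr (j, i) ↦ some i` (block `L_{i+2} = F^n`): "the `i`-th layer of `T` is a block matrix with the
only nonzero block being a diagonal matrix in `L_i ⊗ L_i`" (p0023:L84).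
[cite: BlaserIkenmeyerLysikovPandeySchreyer2019, §6.1 (definition of T_{k,n,r})] -/
theorem bilpsTensor_apply (k' n r : ℕ) (a : Option (Fin k')) (b c : BIdx k' n r) :
    bilpsTensor F k' n r a b c =
      if b = c ∧ Sum.elim (fun _ => (none : Option (Fin k'))) (fun p => some p.2) b = a
      then 1 else 0 := by
  rcases a with _ | i <;> rcases b with j | ⟨j, i₁⟩ <;> rcases c with j' | ⟨j', i₂⟩
  · simp [bilpsTensor]
  · show (0 : F) = _
    simp
  · show (0 : F) = _
    simp
  · show (0 : F) = _
    simp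
  · show (0 : F) = _
    simp
  · show (0 : F) = _
    simp
  · show (0 : F) = _
    simp
  · simp only [bilpsTensor]
    by_cases h : i₁ = i ∧ i₂ = i ∧ j = j'
    · obtain ⟨rfl, rfl, rfl⟩ := h
      simp
    · rw [if_neg h, eq_comm, ite_eq_right_iff]
      simp only [Sum.inr.injEq, Prod.mk.injEq, Sum.elim_inr, Option.some.injEq]
      rintro ⟨⟨rfl, rfl⟩, rfl⟩
      exact absurd ⟨rfl, rfl, rfl⟩ h

variable [Infinite F] (k' n r : ℕ)

/-- The two-parameter family `(diag(x, y, …, y) ⊗ 1 ⊗ 1)·T_{k,n,r}` lies in the orbit closure of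
`T_{k,n,r}` for ALL `x, y` (orbit points for `xy ≠ 0`, p0024:L59; border cases by closure,
p0024:L60). [cite: BlaserIkenmeyerLysikovPandeySchreyer2019, Thm. 22 (proof)] -/
theorem diagFamily_mem_orbitClosure3 (x y : F) :
    trilinearPt (actTensor (diagonal fun a : Option (Fin k') => a.elim x fun _ => y)
        (1 : Matrix (BIdx k' n r) (BIdx k' n r) F) (1 : Matrix (BIdx k' n r) (BIdx k' n r) F)
        (bilpsTensor F k' n r)) ∈ orbitClosure3 (bilpsTensor F k' n r) := by
  set t₀ := bilpsTensor F k' n r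
  let v₀ : Option (Fin k') × BIdx k' n r × BIdx k' n r → F :=
    fun p => if p.1 = none then trilinearPt t₀ p else 0
  let v₁ : Option (Fin k') × BIdx k' n r × BIdx k' n r → F :=
    fun p => if p.1 = none then 0 else trilinearPt t₀ p
  have hfam : ∀ x y : F, x • v₀ + y • v₁ =
      trilinearPt (actTensor (diagonal fun a : Option (Fin k') => a.elim x fun _ => y)
        (1 : Matrix (BIdx k' n r) (BIdx k' n r) F) (1 : Matrix (BIdx k' n r) (BIdx k' n r) F) t₀) := by
    intro x y
    funext p
    obtain ⟨a, b, c⟩ := p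
    simp only [Pi.add_apply, Pi.smul_apply, smul_eq_mul, v₀, v₁, trilinearPt]
    rw [← diagonal_one, actTensor_diagonal_apply]
    rcases a with _ | i <;> simp
  rw [← hfam]
  show x • v₀ + y • v₁ ∈ zariskiClosure (trilinearPt '' glOrbit3 t₀)
  refine smul_add_smul_mem_zariskiClosure _ v₀ v₁ (fun x y hx hy => ?_) x y
  rw [hfam]
  refine ⟨_, ?_, rfl⟩
  obtain ⟨A, hA⟩ := exists_gl_diagonal (fun a : Option (Fin k') => a.elim x fun _ => y)
    (fun a => by rcases a with _ | i <;> simp [hx, hy])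
  exact ⟨A, 1, 1, by rw [hA, Units.val_one]⟩

/-- **Assembly of the printed proof** for a tensor `T ∈ F^k ⊗ L ⊗ L` with
`Stab T ⊇ Stab T_{k,n,r}` (`1 ≤ r`, `1 ≤ n`): `T = (diag(a_1, a_2, …, a_2) ⊗ 1 ⊗ 1)·T_{k,n,r}`
(p0024:L56–58), and the border cases `a_1 = 0`, `a_2 = 0` (the latter only when `k ≥ 2`) have a
strictly larger stabilizer (p0024:L61). [cite: BlaserIkenmeyerLysikovPandeySchreyer2019, Thm. 22 (proof)] -/
theorem exists_eq_actTensor_diagonal (hr : 1 ≤ r) (hn : 1 ≤ n)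
    (T : Option (Fin k') → BIdx k' n r → BIdx k' n r → F)
    (hst : stab3 (bilpsTensor F k' n r) ⊆ stab3 T) :
    ∃ x y : F,
      T = actTensor (diagonal fun a : Option (Fin k') => a.elim x fun _ => y)
        (1 : Matrix (BIdx k' n r) (BIdx k' n r) F) (1 : Matrix (BIdx k' n r) (BIdx k' n r) F)
        (bilpsTensor F k' n r) ∧
      (x = 0 → stab3 T ≠ stab3 (bilpsTensor F k' n r)) ∧
      (∀ i : Fin k', y = 0 → stab3 T ≠ stab3 (bilpsTensor F k' n r)) := by
  classical
  -- the block labelling, representatives, and a scalar `c ∉ {0, 1, -1}`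
  set β : BIdx k' n r → Option (Fin k') :=
    fun b => Sum.elim (fun _ => (none : Option (Fin k'))) (fun p => some p.2) b
  have ht₀ : ∀ a b c, bilpsTensor F k' n r a b c = if b = c ∧ β b = a then 1 else 0 :=
    bilpsTensor_apply F k' n r
  let e : Option (Fin k') → BIdx k' n r :=
    fun a => a.elim (Sum.inl ⟨0, hr⟩) fun i => Sum.inr (⟨0, hn⟩, i)
  have he : ∀ a, β (e a) = a := fun a => by rcases a with _ | i <;> rfl
  obtain ⟨c, hc⟩ := Infinite.exists_notMem_finset ({0, 1, -1} : Finset F)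
  simp only [Finset.mem_insert, Finset.mem_singleton, not_or] at hc
  obtain ⟨hc0, hc1, hcm⟩ := hc
  have hc2 : c * c ≠ 1 := fun h => by
    rcases mul_self_eq_one_iff.1 h with h' | h'
    · exact hc1 h'
    · exact hcm h'
  -- families 1 + 2: block-scalar shape
  have hshape := eq_actTensor_diagonal_of_stab β ht₀ T hst hc0 hc1 hc2 e he
  -- family 3: the coefficients of the blocks `some i` agree
  have hsome : ∀ i j : Fin k', T (some i) (e (some i)) (e (some i)) =
      T (some j) (e (some j)) (e (some j)) := by
    intro i j
    have hcomp : ∀ b, β (blockPerm (n := n) (r := r) (Equiv.swap i j) b) =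
        Equiv.optionCongr (Equiv.swap i j) (β b) := by
      rintro (b | ⟨b, l⟩) <;> rfl
    have h := perm_invariance_of_stab β ht₀ T hst (Equiv.optionCongr (Equiv.swap i j))
      (blockPerm (n := n) (r := r) (Equiv.swap i j)) hcomp (some i) (e (some i)) (e (some i))
    have h1 : (Equiv.optionCongr (Equiv.swap i j)) (some i) = some j := by simp
    have h2 : blockPerm (n := n) (r := r) (Equiv.swap i j) (e (some i)) = e (some j) := by
      simp [e, blockPerm]
    rw [h1, h2] at h
    exact h.symm
  -- the two coefficients
  refine ⟨T none (e none) (e none),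
    if h : 0 < k' then T (some ⟨0, h⟩) (e (some ⟨0, h⟩)) (e (some ⟨0, h⟩)) else 1, ?_, ?_, ?_⟩
  · have hd : (fun a : Option (Fin k') => T a (e a) (e a)) = fun a : Option (Fin k') =>
        a.elim (T none (e none) (e none)) fun _ =>
          if h : 0 < k' then T (some ⟨0, h⟩) (e (some ⟨0, h⟩)) (e (some ⟨0, h⟩)) else 1 := by
      funext a
      rcases a with _ | i
      · rfl
      · have hk : 0 < k' := lt_of_le_of_lt (Nat.zero_le _) i.2
        simp only [Option.elim_some, dif_pos hk]
        exact hsome i ⟨0, hk⟩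
    rw [← hd]
    exact hshape
  · intro hx
    rw [hshape]
    exact stab3_ne_of_coeff_eq_zero β ht₀ _ none hx (e none) (he none) hc0 hc1
  · intro i hy
    have hk : 0 < k' := lt_of_le_of_lt (Nat.zero_le _) i.2
    rw [dif_pos hk] at hy
    rw [hshape]
    refine stab3_ne_of_coeff_eq_zero β ht₀ _ (some i) ?_ (e (some i)) (he (some i)) hc0 hc1
    show T (some i) (e (some i)) (e (some i)) = 0
    rw [hsome i ⟨0, hk⟩]
    exact hy

end Specific

end BILPS2019

/-- **BILPS Thm 22 holds as typed** (`BILPS2019_thm22`, `BILPS19MinrankVarieties.lean`): for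
`1 ≤ r < n` over an algebraically closed field, `Stab T = Stab T_{k,n,r}` puts `T` in the orbit of
`T_{k,n,r}` and `Stab T ⊇ Stab T_{k,n,r}` puts `T` in its orbit closure — by the printed proof
(p0024:L47–62; module docstring). [cite: BlaserIkenmeyerLysikovPandeySchreyer2019, Thm. 22] -/
theorem BILPS2019_thm22_holds : BILPS2019_thm22 := by
  intro F _ _ k' n r hr hrn T
  have hn : 1 ≤ n := le_of_lt (lt_of_le_of_lt hr hrn)
  constructor
  · intro heq
    have hst : stab3 (bilpsTensor F k' n r) ⊆ stab3 T := fun g hg => by rw [heq]; exact hg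
    obtain ⟨x, y, hT, hx, hy⟩ := BILPS2019.exists_eq_actTensor_diagonal F k' n r hr hn T hst
    have hx0 : x ≠ 0 := fun h => hx h heq
    have hy0 : ∀ i : Fin k', y ≠ 0 := fun i h => hy i h heq
    obtain ⟨A, hA⟩ := BILPS2019.exists_gl_diagonal (fun a : Option (Fin k') => a.elim x fun _ => y)
      (fun a => by
        rcases a with _ | i
        · simpa using hx0
        · simpa using hy0 i)
    exact ⟨A, 1, 1, by rw [hA, Units.val_one]; exact hT⟩
  · intro hst
    obtain ⟨x, y, hT, -, -⟩ := BILPS2019.exists_eq_actTensor_diagonal F k' n r hr hn T hst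
    rw [hT]
    exact BILPS2019.diagFamily_mem_orbitClosure3 F k' n r x y

end Literature.Computability.AlgebraicComplexity
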